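import Summits.RiemannHypothesis.RiemannHypothesis.Theorems.WeilColumnBSplineIrwinHall
import Summits.RiemannHypothesis.RiemannHypothesis.Theorems.ThetaTier1Atoms
import HarnessLib

/-!
# The Irwin–Hall BRIDGE: `P.Rtop` and `P.chiL` ARE the arithmetic layer's exact `IH` values (RH-FREE; THETA-ASSIGN W2 / (AR))

Cell `rh-explicit`, WEIL column, seat handoff-prove-2 gen12.  From `WeilColumnBSplineIrwinHall.bsplineCDF_eq_irwinHall` and cc-s2-1's
exact rational Irwin–Hall CDF `ThetaTier1.IH` (`Theorems/ThetaTier1Atoms`):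

* `irwinHall_eq_IH (hn : 1 ≤ n) (s : ℚ) : irwinHall n s = IH n s` (plateaus; truncation of the vanishing terms `j > ⌊s⌋`);
* `ThetaParams.Rtop_eq_irwinHall` / **`ThetaParams.Rtop_eq_IH (hm : 1 ≤ P.m) (τ : ℚ) : P.Rtop τ = ThetaTier1.Rtop P.m τ`** (= `RtopHyp`);
* `ThetaParams.chiL_eq_irwinHall`, `ThetaParams.chiL_nonneg`, **`ThetaParams.chiL_eq_IH`** (for rational `δ`, `η`; = `ChiHyp` with
  equality: `(ofRow r).chiL = IH m (2mδ/η) = r.chiL`).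
Nothing here bears on the truth of RH.
-/

noncomputable section

set_option linter.dupNamespace false

open Complex Set MeasureTheory Filter Finset
open scoped Real Topology

namespace Summit.RiemannHypothesis.RiemannHypothesis.Theorems.WeilColumn.ThetaMellin

open Literature.NumberTheory.LFunctions ThetaParams
open Summit.RiemannHypothesis.RiemannHypothesis.Theorems.ThetaTier1

/-! ## §1 `irwinHall n s = IH n s` at rational points -/

/-- `ihSum` is the partial alternating binomial sum. -/
theorem ihSum_eq_sum (m : ℕ) (s : ℚ) : ∀ J : ℕ,
    ihSum m s J = ∑ j ∈ Finset.range J, (-1 : ℚ) ^ j * (m.choose j : ℚ) * (s - j) ^ m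
  | 0 => by simp [ihSum]
  | J + 1 => by rw [ihSum, ihSum_eq_sum m s J, Finset.sum_range_succ]

/-- `irwinHall n s = 1` for `s ≥ n` (`n ≥ 1`): the upper plateau, through `bsplineCDF_eq_one`. -/
theorem irwinHall_of_ge {n : ℕ} (hn : 1 ≤ n) {s : ℝ} (hs : (n : ℝ) ≤ s) : irwinHall n s = 1 := by
  have h := bsplineCDF_eq_irwinHall (c := 1 / 2) (by norm_num) (n - 1) (s - n / 2)
  have hcast : (((n - 1 : ℕ) : ℝ) + 1) = n := by rw [Nat.cast_sub hn]; push_cast; ring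
  rw [hcast, show n - 1 + 1 = n by omega, show (s - n / 2 + (n : ℝ) * (1 / 2)) / (2 * (1 / 2)) = s by ring] at h
  rw [← h]
  exact bsplineCDF_eq_one (by norm_num) (n - 1) (by rw [hcast]; linarith)

/-- **`irwinHall n s = IH n s`** for rational `s` and `n ≥ 1`. -/
theorem irwinHall_eq_IH {n : ℕ} (hn : 1 ≤ n) (s : ℚ) : irwinHall n (s : ℝ) = ((IH n s : ℚ) : ℝ) := by
  unfold IH
  split_ifs with h0 h1
  · rw [Rat.cast_zero]
    have h0' : (s : ℝ) ≤ 0 := by exact_mod_cast h0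
    exact irwinHall_of_nonpos hn h0'
  · rw [Rat.cast_one]
    have h1' : (n : ℝ) ≤ (s : ℝ) := by exact_mod_cast h1
    exact irwinHall_of_ge hn h1'
  · rw [not_le] at h0 h1
    have hs0 : (0 : ℝ) < s := by exact_mod_cast h0
    rw [ihSum_eq_sum]
    unfold irwinHall
    -- the terms `j > ⌊s⌋` vanish; the others have `max (s − j) 0 = s − j`
    have hfl0 : 0 ≤ ⌊s⌋ := Int.floor_nonneg.2 h0.le
    set J : ℕ := ⌊s⌋.toNat + 1 with hJ
    have hJn : J ≤ n + 1 := by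
      have : ⌊s⌋ < n := Int.floor_lt.2 (by exact_mod_cast h1)
      omega
    have hsub : Finset.range J ⊆ Finset.range (n + 1) := Finset.range_subset_range.2 hJn
    rw [← Finset.sum_subset hsub]
    · push_cast
      rw [div_eq_inv_mul]
      congr 1
      refine Finset.sum_congr rfl fun j hj ↦ ?_
      have hj' : (j : ℤ) ≤ ⌊s⌋ := by have := Finset.mem_range.1 hj; omega
      have hjs : (j : ℝ) ≤ s := by
        have : ((j : ℤ) : ℚ) ≤ s := Int.le_floor.1 hj'
        exact_mod_cast this
      rw [max_eq_left (by linarith)]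
    · intro j hj hjJ
      have hj1 : J ≤ j := by have := Finset.mem_range.not.1 hjJ; omega
      have hjs : (s : ℝ) < j := by
        have : ⌊s⌋ < (j : ℤ) := by omega
        have := Int.floor_lt.1 this
        exact_mod_cast this
      rw [max_eq_right (by linarith), zero_pow (by omega), mul_zero]

/-! ## §2 `P.Rtop` and `P.chiL` in Irwin–Hall currency -/

namespace ThetaParams

variable (P : ThetaParams)

/-- `P.Rtop τ = irwinHall m (mτ/2)` (`m ≥ 1`): `Rtop = 1 − F(1 − τ) = F(τ − 1)` by the CDF symmetry, then Irwin–Hall with `c = 1/m`. -/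
theorem Rtop_eq_irwinHall (hm : 1 ≤ P.m) (τ : ℝ) : P.Rtop τ = irwinHall P.m (P.m * τ / 2) := by
  have hm0 : (0 : ℝ) < P.m := Nat.cast_pos.2 (by omega)
  have hc : 0 < 1 / (P.m : ℝ) := by positivity
  unfold Rtop
  rw [show (1 : ℝ) - τ = -(τ - 1) by ring, bsplineCDF_neg hc, sub_sub_cancel, bsplineCDF_eq_irwinHall hc]
  have hcast : (((P.m - 1 : ℕ) : ℝ) + 1) = P.m := by rw [Nat.cast_sub hm]; push_cast; ring
  rw [show P.m - 1 + 1 = P.m by omega, hcast]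
  congr 1
  field_simp
  ring

/-- **`RtopHyp`**: `P.Rtop τ = Rtop m τ` (cc-s2-1's exact `IH`) at every rational `τ`, `m ≥ 1`. -/
theorem Rtop_eq_IH (hm : 1 ≤ P.m) (τ : ℚ) : P.Rtop τ = ((ThetaTier1.Rtop P.m τ : ℚ) : ℝ) := by
  rw [Rtop_eq_irwinHall P hm, ThetaTier1.Rtop, ← irwinHall_eq_IH hm]
  push_cast
  ring_nf

/-- `P.chiL = irwinHall m (2mδ/η)` (`m ≥ 1`, `η > 0`): the cut at the top of the bottom layer, with `c = η/(2m)`. -/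
theorem chiL_eq_irwinHall (hm : 1 ≤ P.m) (hη : 0 < P.η) : P.chiL = irwinHall P.m (2 * P.m * P.δ / P.η) := by
  have hm0 : (0 : ℝ) < P.m := Nat.cast_pos.2 (by omega)
  have hc : 0 < P.η / (2 * P.m) := by positivity
  unfold chiL cut
  rw [bsplineCDF_eq_irwinHall hc]
  have hcast : (((P.m - 1 : ℕ) : ℝ) + 1) = P.m := by rw [Nat.cast_sub hm]; push_cast; ring
  rw [show P.m - 1 + 1 = P.m by omega, hcast]
  congr 1
  field_simp
  ring

/-- `0 ≤ P.chiL` (`m ≥ 1`, `η > 0`). -/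
theorem chiL_nonneg (hm : 1 ≤ P.m) (hη : 0 < P.η) : 0 ≤ P.chiL := by
  have hm0 : (0 : ℝ) < P.m := Nat.cast_pos.2 (by omega)
  unfold chiL cut
  exact bsplineCDF_nonneg (by positivity) _ _

/-- `P.chiL ≤ 1`. -/
theorem chiL_le_one (hm : 1 ≤ P.m) (hη : 0 < P.η) : P.chiL ≤ 1 := by
  have hm0 : (0 : ℝ) < P.m := Nat.cast_pos.2 (by omega)
  unfold chiL cut
  exact bsplineCDF_le_one (by positivity) _ _

/-- **`ChiHyp` with equality**: for rational `δ = d`, `η = e > 0`: `P.chiL = IH m (2·m·d/e)`. -/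
theorem chiL_eq_IH (hm : 1 ≤ P.m) {d e : ℚ} (hd : P.δ = d) (he : P.η = e) (he0 : 0 < e) :
    P.chiL = ((IH P.m (2 * P.m * d / e) : ℚ) : ℝ) := by
  have hη : 0 < P.η := by rw [he]; exact_mod_cast he0
  rw [chiL_eq_irwinHall P hm hη, hd, he, ← irwinHall_eq_IH hm]
  push_cast
  ring_nf

end ThetaParams

end Summit.RiemannHypothesis.RiemannHypothesis.Theorems.WeilColumn.ThetaMellin

end
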